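import Summits.HubbardSuperconductivity.HubbardSuperconductivity.Theorems.BalabanIRBirComplexStableXYRStubPathCfgD0
import Summits.HubbardSuperconductivity.HubbardSuperconductivity.Theorems.BalabanIRBirComplexStableXYFixedVolumeAction
import Summits.HubbardSuperconductivity.HubbardSuperconductivity.Theorems.BalabanIRBirComplexStableXYRCoreRecentring
import HarnessLib

/-!
# Crux `BirComplexStableXYR`, line `fat-gaussian-defect-calculus`: stub R1 `stub_windowFactorisation`

Registered stub (lead c7, skeleton `Cruxes/BirComplexStableXYR/Lines/fat_gaussian_defect_calculus.lean`), helper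
(`--supports`) for the crux `Summit.HubbardSuperconductivity.HubbardSuperconductivity.Theses.BalabanIR.BirComplexStableXYR`:
**window factorisation of the Gibbs factor through the shifted gradient.**  On the engine's torus
`Λ L M = (Fin 2 → ZMod L) × ZMod M` (chart `TorusChart.piProdZMod 2 L M`), for every real field `φ`, every INTEGER
`1`-cochain `a` and every window Fourier table `c` with (U1) (charge-neutral support),
`e^{−A(φ)} = e^{−(K/2)·Σ_s Q(P_s η)} · Π_s exp(−K·genF c (P_s η) + (K/2)·Q(P_s η))`, `η := d₀φ − 2πa`,
where `P_s ω` is the window path configuration (staircase sums of `ω` from the corner `s`, pinned down by the defining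
hypothesis `hP`) and `Q` is any real functional (in the line: twice the real window Hessian, hypothesis `hQ`, which is
not used by the algebra).

Proof.  (1) Window path identity `genF c (P_s η) = genF c (φ ∘ sh L M s)`: by `stub_pathCfg_d0` and `hP`,
`P_s η w = φ (sh L M s w) − φ s − 2π·z_w` with `z_w ∈ ℤ` the staircase sum of `a`; `genF` is invariant under integer
`2π`-shifts (`CoreRecentring.genF_sub_two_pi_mul_int`) and, under (U1), under the global rotation by `−φ s`
(`birAct_F_rotate`).  (2) Hence `A(φ) = K Σ_s genF c (P_s η)` (unfold `action`).  (3) Bookkeeping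
`−K Σ_s G_s = −(K/2) Σ_s Q_s + Σ_s (−K G_s + (K/2) Q_s)` and `exp_add` / `exp_sum`.  No definitions; sorry-free.
-/

set_option linter.dupNamespace false -- summit = problem name (single-conjunct summit), D-0017

namespace Summit.HubbardSuperconductivity.HubbardSuperconductivity.Theorems.FSUnfolding

open scoped BigOperators
open Literature.MathematicalPhysics.QuantumFieldTheory Literature.Probability.LatticeModels
open Summit.HubbardSuperconductivity.BirComplexStableXYNegative

/-- **`genF` forgets a global rotation and an integer `2π`-shift.**  Under (U1) (`Σ_w n_w = 0` on the support of the
table), if a window configuration `u` differs from `ψ` by a constant `α` and `2π` times an integer configuration `z`,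
then `genF c u = genF c ψ` (`CoreRecentring.genF_sub_two_pi_mul_int` + `birAct_F_rotate`). [folklore] -/
theorem genF_eq_of_forall_eq_sub {r : ℕ} (c : Table r) (hU1 : ∀ n ∈ c.support, ∑ w, n w = 0)
    {u ψ : W r → ℝ} {α : ℝ} {z : W r → ℤ} (hu : ∀ w, u w = ψ w - α - 2 * Real.pi * (z w : ℝ)) :
    genF c u = genF c ψ := by
  calc genF c u
      = genF c (fun w => (ψ w + -α) - 2 * Real.pi * (z w : ℝ)) := by
        congr 1
        funext w
        rw [hu w]
        ring
    _ = genF c (fun w => ψ w + -α) := CoreRecentring.genF_sub_two_pi_mul_int c (fun w => ψ w + -α) z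
    _ = genF c ψ := birAct_F_rotate c hU1 (F := genF c) (fun _ => rfl) ψ (-α)

/-- **The window path identity for `genF`.**  With `P` the window path configuration (staircase sums from the corner
`s`, hypothesis `hP`) and `η = d₀φ − 2πa` (`a` an integer `1`-cochain), `genF c (P_s η) = genF c (φ ∘ sh L M s)` for
every (U1) table `c`: the staircase sum telescopes to `φ (sh L M s w) − φ s − 2π·(integer)` (`stub_pathCfg_d0`), and
`genF` forgets the rotation by `−φ s` and the integer `2π`-shift (`genF_eq_of_forall_eq_sub`). [folklore] -/
theorem genF_pathCfg {r : ℕ} (c : Table r) (hU1 : ∀ n ∈ c.support, ∑ w, n w = 0) (L M : ℕ) [NeZero L] [NeZero M]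
    (P : (Λ L M → Fin 3 → ℝ) → Λ L M → W r → ℝ)
    (hP : ∀ (ω : Λ L M → Fin 3 → ℝ) (s : Λ L M) (w : W r), P ω s w =
      (TorusChart.piProdZMod 2 L M).lineSum ω 0 (w.1 : ℕ) s
        + (TorusChart.piProdZMod 2 L M).lineSum ω 1 (w.2.1 : ℕ) (s + (w.1 : ℕ) • (TorusChart.piProdZMod 2 L M).gen 0)
        + (TorusChart.piProdZMod 2 L M).lineSum ω 2 (w.2.2 : ℕ)
          (s + (w.1 : ℕ) • (TorusChart.piProdZMod 2 L M).gen 0 + (w.2.1 : ℕ) • (TorusChart.piProdZMod 2 L M).gen 1))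
    (φ : Λ L M → ℝ) (a : Λ L M → Fin 3 → ℤ) (s : Λ L M) :
    genF c (P (fun x i => (TorusChart.piProdZMod 2 L M).d₀ φ x i - 2 * Real.pi * (a x i : ℝ)) s)
      = genF c (fun w => φ (sh L M s w)) :=
  genF_eq_of_forall_eq_sub c hU1 (ψ := fun w => φ (sh L M s w)) (α := φ s)
    fun w => (hP _ s w).trans (stub_pathCfg_d0 r L M φ a s w)

/-- **The action through the window path configurations.**  Under (U1), `A(φ) = K · Σ_s genF c (P_s(d₀φ − 2πa))`
for every real field `φ` and every integer `1`-cochain `a` (`genF_pathCfg` summed over the corners). [folklore] -/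
theorem action_eq_mul_sum_genF_pathCfg {r : ℕ} (K : ℝ) (c : Table r) (hU1 : ∀ n ∈ c.support, ∑ w, n w = 0)
    (L M : ℕ) [NeZero L] [NeZero M]
    (P : (Λ L M → Fin 3 → ℝ) → Λ L M → W r → ℝ)
    (hP : ∀ (ω : Λ L M → Fin 3 → ℝ) (s : Λ L M) (w : W r), P ω s w =
      (TorusChart.piProdZMod 2 L M).lineSum ω 0 (w.1 : ℕ) s
        + (TorusChart.piProdZMod 2 L M).lineSum ω 1 (w.2.1 : ℕ) (s + (w.1 : ℕ) • (TorusChart.piProdZMod 2 L M).gen 0)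
        + (TorusChart.piProdZMod 2 L M).lineSum ω 2 (w.2.2 : ℕ)
          (s + (w.1 : ℕ) • (TorusChart.piProdZMod 2 L M).gen 0 + (w.2.1 : ℕ) • (TorusChart.piProdZMod 2 L M).gen 1))
    (φ : Λ L M → ℝ) (a : Λ L M → Fin 3 → ℤ) :
    action K c L M φ
      = (K : ℂ) * ∑ s : Λ L M,
          genF c (P (fun x i => (TorusChart.piProdZMod 2 L M).d₀ φ x i - 2 * Real.pi * (a x i : ℝ)) s) := by
  simp only [action, genF_pathCfg c hU1 L M P hP φ a]

/-- **Exponential bookkeeping.**  For complex numbers `G_s`, real numbers `q_s` and a real `K`,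
`exp(−K Σ_s G_s) = exp(−(K/2) Σ_s q_s) · Π_s exp(−K G_s + (K/2) q_s)` (`exp_add`, `exp_sum`). [folklore] -/
theorem exp_neg_mul_sum_eq_mul_prod {ι : Type*} [Fintype ι] (K : ℝ) (G : ι → ℂ) (q : ι → ℝ) :
    Complex.exp (-((K : ℂ) * ∑ s, G s))
      = Complex.exp (-(((K / 2 * ∑ s, q s : ℝ)) : ℂ)) *
          ∏ s, Complex.exp (-((K : ℂ) * G s) + ((K / 2 * q s : ℝ) : ℂ)) := by
  rw [← Complex.exp_sum, ← Complex.exp_add]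
  congr 1
  push_cast
  simp only [Finset.mul_sum, Finset.sum_add_distrib, Finset.sum_neg_distrib]
  ring

/-- **Stub R1 `stub_windowFactorisation` (registered signature, verbatim): window factorisation of the Gibbs factor
through the shifted gradient.**  For every real field `φ`, every INTEGER `1`-cochain `a` and every table with (U1):
`e^{−A(φ)} = e^{−(K/2)·Σ_s Q(P_s(d₀φ − 2πa))} · Π_s exp(−K·genF c (P_s(d₀φ − 2πa)) + (K/2)·Q(P_s(d₀φ − 2πa)))` — the
window path identity `genF c (φ ∘ sh s) = genF c (P_s(d₀φ − 2πa))` ((U1): `birAct_F_rotate`; periodicity: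
`genF_sub_two_pi_mul_int`; telescoping: `stub_pathCfg_d0`) followed by `exp_sum`/`exp_add` bookkeeping.  The second
factor is the product of the bounded local complex factors `R_s`; the first is the thin Gaussian. [folklore] -/
theorem stub_windowFactorisation :
    ∀ (r : ℕ) (K : ℝ) (c : Table r), (∀ n ∈ c.support, ∑ w, n w = 0) → ∀ (L M : ℕ) [NeZero L] [NeZero M]
      (P : (Λ L M → Fin 3 → ℝ) → Λ L M → W r → ℝ),
      (∀ (ω : Λ L M → Fin 3 → ℝ) (s : Λ L M) (w : W r), P ω s w =
        (TorusChart.piProdZMod 2 L M).lineSum ω 0 (w.1 : ℕ) s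
          + (TorusChart.piProdZMod 2 L M).lineSum ω 1 (w.2.1 : ℕ) (s + (w.1 : ℕ) • (TorusChart.piProdZMod 2 L M).gen 0)
          + (TorusChart.piProdZMod 2 L M).lineSum ω 2 (w.2.2 : ℕ)
            (s + (w.1 : ℕ) • (TorusChart.piProdZMod 2 L M).gen 0 + (w.2.1 : ℕ) • (TorusChart.piProdZMod 2 L M).gen 1)) →
      ∀ (Q : (W r → ℝ) → ℝ),
      (∀ u : W r → ℝ, Q u = (-c.sum (fun n a => a * (((∑ w, (n w : ℝ) * u w) ^ 2 : ℝ) : ℂ))).re) →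
      ∀ (φ : Λ L M → ℝ) (a : Λ L M → Fin 3 → ℤ),
        Complex.exp (-(action K c L M φ)) =
          Complex.exp (-(((K / 2 * ∑ s : Λ L M,
              Q (P (fun x i => (TorusChart.piProdZMod 2 L M).d₀ φ x i - 2 * Real.pi * (a x i : ℝ)) s)) : ℝ) : ℂ)) *
          ∏ s : Λ L M, Complex.exp
            (-((K : ℂ) * genF c (P (fun x i => (TorusChart.piProdZMod 2 L M).d₀ φ x i - 2 * Real.pi * (a x i : ℝ)) s))
              + (((K / 2 * Q (P (fun x i => (TorusChart.piProdZMod 2 L M).d₀ φ x i - 2 * Real.pi * (a x i : ℝ)) s)) : ℝ) : ℂ)) := by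
  intro r K c hU1 L M _ _ P hP Q _ φ a
  rw [action_eq_mul_sum_genF_pathCfg K c hU1 L M P hP φ a]
  exact exp_neg_mul_sum_eq_mul_prod K _ _

end Summit.HubbardSuperconductivity.HubbardSuperconductivity.Theorems.FSUnfolding
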